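import Summits.BirchSwinnertonDyer.Rank1Residual.X10.CasselsTatePairingRecords
import HarnessLib

/-!
# X10b at `p = 3`, rank `0`, `ord₃ #Ш_an = 2`: per-pair kernel records of the CTP-on-Sel³ certificate shape — part B (eight further target documents of record) (cell `b2b-bsdres`, unit `b2b-bsdres-x10`, gen 12)

HONEST FRAMING (run/shared/lean/b2b/bsd-rank1-residual/, verbatim in every file): the goal of the
cell is to DELETE the COMBINATION-SHAPED residual classes of the Birch–Swinnerton-Dyer formula for
ALL analytic-rank `≤ 1` elliptic curves over `ℚ` — "full BSD formula for every rank `≤ 1` curve in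
class `C`" assembled STRICTLY from published theorems — so that the rank-`≤ 1` remainder becomes
exactly the CONSTRUCTION-SHAPED classes, which are TYPED (missing-input `Prop`s), NOT attempted.
This is not "finishing BSD". Theorems only; NOTHING IS BOOKED HERE; no class label changes (X10b stays
CONSTRUCTION-SHAPED, referee R82.3 / R106.7). Per pair.

Continuation of `X10/CasselsTatePairingRecords.lean` (same generic consumer
`X10.bsdp_three_of_ainvs_of_ctpGram`, same binder status: the pairing binders are the ctp-sel3/1.1
TARGET documents of record, route A's matrix only, VERIFIER B UNREAD at the time of writing —
engines RULINGS R-281(d) queue; the cell referee's R106.7 governs any booking) for the remaining eight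
target documents `110224f1, 129605x1, 183184b1, 186050n1, 305762d1, 322624k1, 327184dt1, 427130j1`; split only
for the 400-line file rule. References as in part A. [cite: FisherNewton2014, Thm. 1.3]
[cite: Miller2011LMS, Def. 1.1] [cite: Mazur1978, §6 Prop. 6.3 (1) (p. 153)] [cite: Kraus1989, Prop. 1]
-/

set_option autoImplicit false

noncomputable section

open scoped Classical

open WeierstrassCurve Literature.NumberTheory.EllipticCurves
  Literature.NumberTheory.EllipticCurves.Rank1Residual
  Literature.NumberTheory.EllipticCurves.Rank1Residual.Typed
  Literature.NumberTheory.EllipticCurves.Rank1Residual.X11RankOneCertificates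
  Summit.BirchSwinnertonDyer.BirchSwinnertonDyer.Rank1Residual.IntModel
  Summit.BirchSwinnertonDyer.BirchSwinnertonDyer.Rank1Residual.X11RankOne
  Summit.BirchSwinnertonDyer.Rank1Residual.X11b

namespace Summit.BirchSwinnertonDyer.Rank1Residual.X10

/-! ### §1. Frobenius point-count witnesses for irreducibility of `E[3]` (kernel-decided data) -/
/-- `#Ẽ(𝔽_{19}) = 14` (`a_{19} = 6`; `X² − 6X + 19` is root-free mod `3`) for Cremona's model `129605x1` (kernel count). [folklore] -/
theorem card_t129605x1_19 :
    Nat.card (((⟨0, -1, 1, -397455, -265605047⟩ : WeierstrassCurve ℤ).map (Int.castRingHom (ZMod 19))).toAffine.Point) = 14 := by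
  rw [@WeierstrassCurve.natCard_point_eq_one_add_card (ZMod 19) (@ZMod.instField 19 ⟨by norm_num⟩) _ _ _
    (by decide +kernel), @card_sol_eq_sum_euler (ZMod 19) (@ZMod.instField 19 ⟨by norm_num⟩) _ _
    (by rw [ZMod.ringChar_zmod_n]; decide), ZMod.card]
  decide +kernel

/-- `#Ẽ(𝔽_{7}) = 8` (`a_{7} = 0`; `X² + 7` is root-free mod `3`) for Cremona's model `183184b1` (kernel count). [folklore] -/
theorem card_t183184b1_7 :
    Nat.card (((⟨0, 1, 0, -4491824, -94543873196⟩ : WeierstrassCurve ℤ).map (Int.castRingHom (ZMod 7))).toAffine.Point) = 8 := by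
  rw [@WeierstrassCurve.natCard_point_eq_one_add_card (ZMod 7) (@ZMod.instField 7 ⟨by norm_num⟩) _ _ _
    (by decide +kernel), @card_sol_eq_sum_euler (ZMod 7) (@ZMod.instField 7 ⟨by norm_num⟩) _ _
    (by rw [ZMod.ringChar_zmod_n]; decide), ZMod.card]
  decide +kernel

/-- `#Ẽ(𝔽_{7}) = 5` (`a_{7} = 3`; `X² − 3X + 7` is root-free mod `3`) for Cremona's model `186050n1` (kernel count). [folklore] -/
theorem card_t186050n1_7 :
    Nat.card (((⟨1, 0, 1, -1536851, -5254416402⟩ : WeierstrassCurve ℤ).map (Int.castRingHom (ZMod 7))).toAffine.Point) = 5 := by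
  rw [@WeierstrassCurve.natCard_point_eq_one_add_card (ZMod 7) (@ZMod.instField 7 ⟨by norm_num⟩) _ _ _
    (by decide +kernel), @card_sol_eq_sum_euler (ZMod 7) (@ZMod.instField 7 ⟨by norm_num⟩) _ _
    (by rw [ZMod.ringChar_zmod_n]; decide), ZMod.card]
  decide +kernel

/-- `#Ẽ(𝔽_{7}) = 5` (`a_{7} = 3`; `X² − 3X + 7` is root-free mod `3`) for Cremona's model `305762d1` (kernel count). [folklore] -/
theorem card_t305762d1_7 :
    Nat.card (((⟨1, 1, 0, -165191105, -959737799051⟩ : WeierstrassCurve ℤ).map (Int.castRingHom (ZMod 7))).toAffine.Point) = 5 := by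
  rw [@WeierstrassCurve.natCard_point_eq_one_add_card (ZMod 7) (@ZMod.instField 7 ⟨by norm_num⟩) _ _ _
    (by decide +kernel), @card_sol_eq_sum_euler (ZMod 7) (@ZMod.instField 7 ⟨by norm_num⟩) _ _
    (by rw [ZMod.ringChar_zmod_n]; decide), ZMod.card]
  decide +kernel

/-- `#Ẽ(𝔽_{7}) = 5` (`a_{7} = 3`; `X² − 3X + 7` is root-free mod `3`) for Cremona's model `322624k1` (kernel count). [folklore] -/
theorem card_t322624k1_7 :
    Nat.card (((⟨0, -1, 0, -45335393, -116524739615⟩ : WeierstrassCurve ℤ).map (Int.castRingHom (ZMod 7))).toAffine.Point) = 5 := by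
  rw [@WeierstrassCurve.natCard_point_eq_one_add_card (ZMod 7) (@ZMod.instField 7 ⟨by norm_num⟩) _ _ _
    (by decide +kernel), @card_sol_eq_sum_euler (ZMod 7) (@ZMod.instField 7 ⟨by norm_num⟩) _ _
    (by rw [ZMod.ringChar_zmod_n]; decide), ZMod.card]
  decide +kernel

/-- `#Ẽ(𝔽_{7}) = 5` (`a_{7} = 3`; `X² − 3X + 7` is root-free mod `3`) for Cremona's model `327184dt1` (kernel count). [folklore] -/
theorem card_t327184dt1_7 :
    Nat.card (((⟨0, 1, 0, 974736, -1134484012⟩ : WeierstrassCurve ℤ).map (Int.castRingHom (ZMod 7))).toAffine.Point) = 5 := by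
  rw [@WeierstrassCurve.natCard_point_eq_one_add_card (ZMod 7) (@ZMod.instField 7 ⟨by norm_num⟩) _ _ _
    (by decide +kernel), @card_sol_eq_sum_euler (ZMod 7) (@ZMod.instField 7 ⟨by norm_num⟩) _ _
    (by rw [ZMod.ringChar_zmod_n]; decide), ZMod.card]
  decide +kernel

/-- `#Ẽ(𝔽_{7}) = 5` (`a_{7} = 3`; `X² − 3X + 7` is root-free mod `3`) for Cremona's model `427130j1` (kernel count). [folklore] -/
theorem card_t427130j1_7 :
    Nat.card (((⟨1, 1, 0, -2255337878, -41220294842668⟩ : WeierstrassCurve ℤ).map (Int.castRingHom (ZMod 7))).toAffine.Point) = 5 := by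
  rw [@WeierstrassCurve.natCard_point_eq_one_add_card (ZMod 7) (@ZMod.instField 7 ⟨by norm_num⟩) _ _ _
    (by decide +kernel), @card_sol_eq_sum_euler (ZMod 7) (@ZMod.instField 7 ⟨by norm_num⟩) _ _
    (by rw [ZMod.ringChar_zmod_n]; decide), ZMod.card]
  decide +kernel

/-- `#Ẽ(𝔽_{13}) = 8` (`a_{13} = 6`; `X² − 6X + 13` is root-free mod `3`) for Cremona's model `110224f1` (kernel count). [folklore] -/
theorem card_t110224f1_13 :
    Nat.card (((⟨0, 1, 0, -6670848, -12548797516⟩ : WeierstrassCurve ℤ).map (Int.castRingHom (ZMod 13))).toAffine.Point) = 8 := by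
  rw [@WeierstrassCurve.natCard_point_eq_one_add_card (ZMod 13) (@ZMod.instField 13 ⟨by norm_num⟩) _ _ _
    (by decide +kernel), @card_sol_eq_sum_euler (ZMod 13) (@ZMod.instField 13 ⟨by norm_num⟩) _ _
    (by rw [ZMod.ringChar_zmod_n]; decide), ZMod.card]
  decide +kernel

/-! ### §2. The records (eight further ctp-sel3/1.1 target documents of record) -/

/-- **`BSD(E,3)` for `110224f1` from the CTP-on-Sel³ certificate shape** (`N = 110224`; Cremona model
`[0, 1, 0, -6670848, -12548797516]`; `3 ∤ N`: GOOD ORDINARY at `3`; `ρ̄_{E,3}` irreducible, NOT surjective, normaliser-of-split-Cartan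
type `3Ns` — class X10b; analytic rank `0`; `#Ш_an = 9` (`ord₃ = 2`); census: Cha-certified under flag). Displayed binders:
`hGZK`; `r_an = 0`, `ord₃ #Ш_an = 2` (Cremona / engines); `hcard` = the exact `3`-descent line
`dim_𝔽₃ Sel^(3)(E/ℚ) = 2` (two engines, T2-BATCH-G10); the pairing binders = the ctp-sel3/1.1 TARGET
document `ctp_cert_110224f1.json` of `HOME/b2b-bsdres-x10/g10/ctp-sel3/certs/` (route A's matrix `G = [0 −1; 1 0]`,
alternating, rank `2`; VERIFIER B UNREAD at the time of writing — R-281(d) queue; referee R106.7 governs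
booking). GLOBAL MINIMALITY of Cremona's model is a DISPLAYED HYPOTHESIS `hmin` for this record (additive at `2` with `2⁴ ∣ c₄`, `2⁶ ∥ c₆`:
outside the tree's bounded Kraus clauses F2a/F2c of `isGloballyMinimal_of_krausCriterion_bounded₂`; Kraus 1989 Prop. 2 in print). Kernel-decided here: `Δ ≠ 0`, `E[3]` irreducible (`ℓ = 13`,
`#Ẽ(𝔽_{13}) = 8`, `a_{13} = 6`). Per pair; books nothing.
[cite: Miller2011LMS, Def. 1.1] [cite: FisherNewton2014, Thm. 1.3] [cite: Cremona2006, Table 1 (Cremona label 110224f1)] -/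
theorem bsdp_t110224f1 (hGZK : rank_eq_analyticRank_of_analyticRank_le_one)
    (W : WeierstrassCurve ℚ) (hW : W = ⟨0, 1, 0, -6670848, -12548797516⟩) [hmin : W.IsGloballyMinimal]
    (hr : W.analyticRank = 0) (hcard : Nat.card (W.selmerGroup (3 : ℤ)) = 9)
    {Q : Type*} [AddCommGroup Q] (B : W.sha →+ W.sha →+ Q) {x₁ x₂ : W.sha}
    (hx₁ : 3 • x₁ = 0) (hx₂ : 3 • x₂ = 0)
    (h₁₁ : B x₁ x₁ = 0) (h₂₂ : B x₂ x₂ = 0) (h₁₂ : B x₁ x₂ ≠ 0) (h₂₁ : B x₂ x₁ ≠ 0)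
    {q : ℚ} (hq : shaAn W = (q : ℂ)) (hv : padicValRat 3 q = 2) : BSDp W 3 := by
  subst hW
  have hE := isElliptic_of_discOf_ne_zero 0 1 0 (-6670848) (-12548797516) (by decide +kernel)
  have hM := hmin
  haveI : Fact (Nat.Prime 13) := ⟨by norm_num⟩
  exact @bsdp_three_of_ainvs_of_ctpGram hGZK 0 1 0 (-6670848) (-12548797516) _ hE hM
    (@integralModelInt_eq_of_map_eq _ hM _ (map_mk_int _ _ _ _ _)) 13 8 _ (by decide) (by decide +kernel)
    card_t110224f1_13 (by decide +kernel) hr hcard Q _ B x₁ x₂ hx₁ hx₂ h₁₁ h₂₂ h₁₂ h₂₁ q hq hv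
/-- **`BSD(E,3)` for `129605x1` from the CTP-on-Sel³ certificate shape** (`N = 129605`; Cremona model
`[0, -1, 1, -397455, -265605047]`; `3 ∤ N`: GOOD ORDINARY at `3`; `ρ̄_{E,3}` irreducible, NOT surjective, normaliser-of-split-Cartan
type `3Ns` — class X10b; analytic rank `0`; `#Ш_an = 9` (`ord₃ = 2`); census: Jetchev-closable (q = 5; p206000)). Displayed binders:
`hGZK`; `r_an = 0`, `ord₃ #Ш_an = 2` (Cremona / engines); `hcard` = the exact `3`-descent line
`dim_𝔽₃ Sel^(3)(E/ℚ) = 2` (two engines, T2-BATCH-G10); the pairing binders = the ctp-sel3/1.1 TARGET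
document `ctp_cert_129605x1.json` of `HOME/b2b-bsdres-x10/g10/ctp-sel3/certs/` (route A's matrix `G = [0 −1; 1 0]`,
alternating, rank `2`; VERIFIER B UNREAD at the time of writing — R-281(d) queue; referee R106.7 governs
booking). Kernel-decided here: `Δ ≠ 0`, global minimality (Kraus), `E[3]` irreducible (`ℓ = 19`,
`#Ẽ(𝔽_{19}) = 14`, `a_{19} = 6`). Per pair; books nothing.
[cite: Miller2011LMS, Def. 1.1] [cite: FisherNewton2014, Thm. 1.3] [cite: Cremona2006, Table 1 (Cremona label 129605x1)] -/
theorem bsdp_t129605x1 (hGZK : rank_eq_analyticRank_of_analyticRank_le_one)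
    (W : WeierstrassCurve ℚ) (hW : W = ⟨0, -1, 1, -397455, -265605047⟩)
    (hr : W.analyticRank = 0) (hcard : Nat.card (W.selmerGroup (3 : ℤ)) = 9)
    {Q : Type*} [AddCommGroup Q] (B : W.sha →+ W.sha →+ Q) {x₁ x₂ : W.sha}
    (hx₁ : 3 • x₁ = 0) (hx₂ : 3 • x₂ = 0)
    (h₁₁ : B x₁ x₁ = 0) (h₂₂ : B x₂ x₂ = 0) (h₁₂ : B x₁ x₂ ≠ 0) (h₂₁ : B x₂ x₁ ≠ 0)
    {q : ℚ} (hq : shaAn W = (q : ℂ)) (hv : padicValRat 3 q = 2) : BSDp W 3 := by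
  subst hW
  have hE := isElliptic_of_discOf_ne_zero 0 (-1) 1 (-397455) (-265605047) (by decide +kernel)
  have hM := isGloballyMinimal_of_krausCriterion_bounded₂ 0 (-1) 1 (-397455) (-265605047) (by decide +kernel)
    (by decide +kernel) (by decide +kernel)
  haveI : Fact (Nat.Prime 19) := ⟨by norm_num⟩
  exact @bsdp_three_of_ainvs_of_ctpGram hGZK 0 (-1) 1 (-397455) (-265605047) _ hE hM
    (@integralModelInt_eq_of_map_eq _ hM _ (map_mk_int _ _ _ _ _)) 19 14 _ (by decide) (by decide +kernel)
    card_t129605x1_19 (by decide +kernel) hr hcard Q _ B x₁ x₂ hx₁ hx₂ h₁₁ h₂₂ h₁₂ h₂₁ q hq hv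

/-- **`BSD(E,3)` for `183184b1` from the CTP-on-Sel³ certificate shape** (`N = 183184`; Cremona model
`[0, 1, 0, -4491824, -94543873196]`; `3 ∤ N`: GOOD ORDINARY at `3`; `ρ̄_{E,3}` irreducible, NOT surjective, normaliser-of-split-Cartan
type `3Ns` — class X10b; analytic rank `0`; `#Ш_an = 9` (`ord₃ = 2`); census: Cha-certified under flag). Displayed binders:
`hGZK`; `r_an = 0`, `ord₃ #Ш_an = 2` (Cremona / engines); `hcard` = the exact `3`-descent line
`dim_𝔽₃ Sel^(3)(E/ℚ) = 2` (two engines, T2-BATCH-G10); the pairing binders = the ctp-sel3/1.1 TARGET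
document `ctp_cert_183184b1.json` of `HOME/b2b-bsdres-x10/g10/ctp-sel3/certs/` (route A's matrix `G = [0 −1; 1 0]`,
alternating, rank `2`; VERIFIER B UNREAD at the time of writing — R-281(d) queue; referee R106.7 governs
booking). GLOBAL MINIMALITY of Cremona's model is a DISPLAYED HYPOTHESIS `hmin` for this record (additive at `2` with `2⁴ ∣ c₄`, `2⁶ ∥ c₆`:
outside the tree's bounded Kraus clauses F2a/F2c of `isGloballyMinimal_of_krausCriterion_bounded₂`; Kraus 1989 Prop. 2 in print). Kernel-decided here: `Δ ≠ 0`, `E[3]` irreducible (`ℓ = 7`,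
`#Ẽ(𝔽_{7}) = 8`, `a_{7} = 0`). Per pair; books nothing.
[cite: Miller2011LMS, Def. 1.1] [cite: FisherNewton2014, Thm. 1.3] [cite: Cremona2006, Table 1 (Cremona label 183184b1)] -/
theorem bsdp_t183184b1 (hGZK : rank_eq_analyticRank_of_analyticRank_le_one)
    (W : WeierstrassCurve ℚ) (hW : W = ⟨0, 1, 0, -4491824, -94543873196⟩) [hmin : W.IsGloballyMinimal]
    (hr : W.analyticRank = 0) (hcard : Nat.card (W.selmerGroup (3 : ℤ)) = 9)
    {Q : Type*} [AddCommGroup Q] (B : W.sha →+ W.sha →+ Q) {x₁ x₂ : W.sha}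
    (hx₁ : 3 • x₁ = 0) (hx₂ : 3 • x₂ = 0)
    (h₁₁ : B x₁ x₁ = 0) (h₂₂ : B x₂ x₂ = 0) (h₁₂ : B x₁ x₂ ≠ 0) (h₂₁ : B x₂ x₁ ≠ 0)
    {q : ℚ} (hq : shaAn W = (q : ℂ)) (hv : padicValRat 3 q = 2) : BSDp W 3 := by
  subst hW
  have hE := isElliptic_of_discOf_ne_zero 0 1 0 (-4491824) (-94543873196) (by decide +kernel)
  have hM := hmin
  haveI : Fact (Nat.Prime 7) := ⟨by norm_num⟩
  exact @bsdp_three_of_ainvs_of_ctpGram hGZK 0 1 0 (-4491824) (-94543873196) _ hE hM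
    (@integralModelInt_eq_of_map_eq _ hM _ (map_mk_int _ _ _ _ _)) 7 8 _ (by decide) (by decide +kernel)
    card_t183184b1_7 (by decide +kernel) hr hcard Q _ B x₁ x₂ hx₁ hx₂ h₁₁ h₂₂ h₁₂ h₂₁ q hq hv

/-- **`BSD(E,3)` for `186050n1` from the CTP-on-Sel³ certificate shape** (`N = 186050`; Cremona model
`[1, 0, 1, -1536851, -5254416402]`; `3 ∤ N`: GOOD ORDINARY at `3`; `ρ̄_{E,3}` irreducible, NOT surjective, normaliser-of-split-Cartan
type `3Ns` — class X10b; analytic rank `0`; `#Ш_an = 9` (`ord₃ = 2`); census: Cha-certified under flag). Displayed binders: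
`hGZK`; `r_an = 0`, `ord₃ #Ш_an = 2` (Cremona / engines); `hcard` = the exact `3`-descent line
`dim_𝔽₃ Sel^(3)(E/ℚ) = 2` (two engines, T2-BATCH-G10); the pairing binders = the ctp-sel3/1.1 TARGET
document `ctp_cert_186050n1.json` of `HOME/b2b-bsdres-x10/g10/ctp-sel3/certs/` (route A's matrix `G = [0 −1; 1 0]`,
alternating, rank `2`; VERIFIER B UNREAD at the time of writing — R-281(d) queue; referee R106.7 governs
booking). Kernel-decided here: `Δ ≠ 0`, global minimality (Kraus), `E[3]` irreducible (`ℓ = 7`,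
`#Ẽ(𝔽_{7}) = 5`, `a_{7} = 3`). Per pair; books nothing.
[cite: Miller2011LMS, Def. 1.1] [cite: FisherNewton2014, Thm. 1.3] [cite: Cremona2006, Table 1 (Cremona label 186050n1)] -/
theorem bsdp_t186050n1 (hGZK : rank_eq_analyticRank_of_analyticRank_le_one)
    (W : WeierstrassCurve ℚ) (hW : W = ⟨1, 0, 1, -1536851, -5254416402⟩)
    (hr : W.analyticRank = 0) (hcard : Nat.card (W.selmerGroup (3 : ℤ)) = 9)
    {Q : Type*} [AddCommGroup Q] (B : W.sha →+ W.sha →+ Q) {x₁ x₂ : W.sha}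
    (hx₁ : 3 • x₁ = 0) (hx₂ : 3 • x₂ = 0)
    (h₁₁ : B x₁ x₁ = 0) (h₂₂ : B x₂ x₂ = 0) (h₁₂ : B x₁ x₂ ≠ 0) (h₂₁ : B x₂ x₁ ≠ 0)
    {q : ℚ} (hq : shaAn W = (q : ℂ)) (hv : padicValRat 3 q = 2) : BSDp W 3 := by
  subst hW
  have hE := isElliptic_of_discOf_ne_zero 1 0 1 (-1536851) (-5254416402) (by decide +kernel)
  have hM := isGloballyMinimal_of_krausCriterion_bounded₂ 1 0 1 (-1536851) (-5254416402) (by decide +kernel)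
    (by decide +kernel) (by decide +kernel)
  haveI : Fact (Nat.Prime 7) := ⟨by norm_num⟩
  exact @bsdp_three_of_ainvs_of_ctpGram hGZK 1 0 1 (-1536851) (-5254416402) _ hE hM
    (@integralModelInt_eq_of_map_eq _ hM _ (map_mk_int _ _ _ _ _)) 7 5 _ (by decide) (by decide +kernel)
    card_t186050n1_7 (by decide +kernel) hr hcard Q _ B x₁ x₂ hx₁ hx₂ h₁₁ h₂₂ h₁₂ h₂₁ q hq hv

/-- **`BSD(E,3)` for `305762d1` from the CTP-on-Sel³ certificate shape** (`N = 305762`; Cremona model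
`[1, 1, 0, -165191105, -959737799051]`; `3 ∤ N`: GOOD ORDINARY at `3`; `ρ̄_{E,3}` irreducible, NOT surjective, normaliser-of-split-Cartan
type `3Ns` — class X10b; analytic rank `0`; `#Ш_an = 9` (`ord₃ = 2`); census: Cha-certified under flag). Displayed binders:
`hGZK`; `r_an = 0`, `ord₃ #Ш_an = 2` (Cremona / engines); `hcard` = the exact `3`-descent line
`dim_𝔽₃ Sel^(3)(E/ℚ) = 2` (two engines, T2-BATCH-G10); the pairing binders = the ctp-sel3/1.1 TARGET
document `ctp_cert_305762d1.json` of `HOME/b2b-bsdres-x10/g10/ctp-sel3/certs/` (route A's matrix `G = [0 −1; 1 0]`,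
alternating, rank `2`; VERIFIER B UNREAD at the time of writing — R-281(d) queue; referee R106.7 governs
booking). Kernel-decided here: `Δ ≠ 0`, global minimality (Kraus), `E[3]` irreducible (`ℓ = 7`,
`#Ẽ(𝔽_{7}) = 5`, `a_{7} = 3`). Per pair; books nothing.
[cite: Miller2011LMS, Def. 1.1] [cite: FisherNewton2014, Thm. 1.3] [cite: Cremona2006, Table 1 (Cremona label 305762d1)] -/
theorem bsdp_t305762d1 (hGZK : rank_eq_analyticRank_of_analyticRank_le_one)
    (W : WeierstrassCurve ℚ) (hW : W = ⟨1, 1, 0, -165191105, -959737799051⟩)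
    (hr : W.analyticRank = 0) (hcard : Nat.card (W.selmerGroup (3 : ℤ)) = 9)
    {Q : Type*} [AddCommGroup Q] (B : W.sha →+ W.sha →+ Q) {x₁ x₂ : W.sha}
    (hx₁ : 3 • x₁ = 0) (hx₂ : 3 • x₂ = 0)
    (h₁₁ : B x₁ x₁ = 0) (h₂₂ : B x₂ x₂ = 0) (h₁₂ : B x₁ x₂ ≠ 0) (h₂₁ : B x₂ x₁ ≠ 0)
    {q : ℚ} (hq : shaAn W = (q : ℂ)) (hv : padicValRat 3 q = 2) : BSDp W 3 := by
  subst hW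
  have hE := isElliptic_of_discOf_ne_zero 1 1 0 (-165191105) (-959737799051) (by decide +kernel)
  have hM := isGloballyMinimal_of_krausCriterion_bounded₂ 1 1 0 (-165191105) (-959737799051) (by decide +kernel)
    (by decide +kernel) (by decide +kernel)
  haveI : Fact (Nat.Prime 7) := ⟨by norm_num⟩
  exact @bsdp_three_of_ainvs_of_ctpGram hGZK 1 1 0 (-165191105) (-959737799051) _ hE hM
    (@integralModelInt_eq_of_map_eq _ hM _ (map_mk_int _ _ _ _ _)) 7 5 _ (by decide) (by decide +kernel)
    card_t305762d1_7 (by decide +kernel) hr hcard Q _ B x₁ x₂ hx₁ hx₂ h₁₁ h₂₂ h₁₂ h₂₁ q hq hv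

/-- **`BSD(E,3)` for `322624k1` from the CTP-on-Sel³ certificate shape** (`N = 322624`; Cremona model
`[0, -1, 0, -45335393, -116524739615]`; `3 ∤ N`: GOOD ORDINARY at `3`; `ρ̄_{E,3}` irreducible, NOT surjective, normaliser-of-split-Cartan
type `3Ns` — class X10b; analytic rank `0`; `#Ш_an = 9` (`ord₃ = 2`); census: Cha-certified under flag). Displayed binders:
`hGZK`; `r_an = 0`, `ord₃ #Ш_an = 2` (Cremona / engines); `hcard` = the exact `3`-descent line
`dim_𝔽₃ Sel^(3)(E/ℚ) = 2` (two engines, T2-BATCH-G10); the pairing binders = the ctp-sel3/1.1 TARGET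
document `ctp_cert_322624k1.json` of `HOME/b2b-bsdres-x10/g10/ctp-sel3/certs/` (route A's matrix `G = [0 1; −1 0]`,
alternating, rank `2`; VERIFIER B UNREAD at the time of writing — R-281(d) queue; referee R106.7 governs
booking). Kernel-decided here: `Δ ≠ 0`, global minimality (Kraus), `E[3]` irreducible (`ℓ = 7`,
`#Ẽ(𝔽_{7}) = 5`, `a_{7} = 3`). Per pair; books nothing.
[cite: Miller2011LMS, Def. 1.1] [cite: FisherNewton2014, Thm. 1.3] [cite: Cremona2006, Table 1 (Cremona label 322624k1)] -/
theorem bsdp_t322624k1 (hGZK : rank_eq_analyticRank_of_analyticRank_le_one)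
    (W : WeierstrassCurve ℚ) (hW : W = ⟨0, -1, 0, -45335393, -116524739615⟩)
    (hr : W.analyticRank = 0) (hcard : Nat.card (W.selmerGroup (3 : ℤ)) = 9)
    {Q : Type*} [AddCommGroup Q] (B : W.sha →+ W.sha →+ Q) {x₁ x₂ : W.sha}
    (hx₁ : 3 • x₁ = 0) (hx₂ : 3 • x₂ = 0)
    (h₁₁ : B x₁ x₁ = 0) (h₂₂ : B x₂ x₂ = 0) (h₁₂ : B x₁ x₂ ≠ 0) (h₂₁ : B x₂ x₁ ≠ 0)
    {q : ℚ} (hq : shaAn W = (q : ℂ)) (hv : padicValRat 3 q = 2) : BSDp W 3 := by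
  subst hW
  have hE := isElliptic_of_discOf_ne_zero 0 (-1) 0 (-45335393) (-116524739615) (by decide +kernel)
  have hM := isGloballyMinimal_of_krausCriterion_bounded₂ 0 (-1) 0 (-45335393) (-116524739615) (by decide +kernel)
    (by decide +kernel) (by decide +kernel)
  haveI : Fact (Nat.Prime 7) := ⟨by norm_num⟩
  exact @bsdp_three_of_ainvs_of_ctpGram hGZK 0 (-1) 0 (-45335393) (-116524739615) _ hE hM
    (@integralModelInt_eq_of_map_eq _ hM _ (map_mk_int _ _ _ _ _)) 7 5 _ (by decide) (by decide +kernel)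
    card_t322624k1_7 (by decide +kernel) hr hcard Q _ B x₁ x₂ hx₁ hx₂ h₁₁ h₂₂ h₁₂ h₂₁ q hq hv

/-- **`BSD(E,3)` for `327184dt1` from the CTP-on-Sel³ certificate shape** (`N = 327184`; Cremona model
`[0, 1, 0, 974736, -1134484012]`; `3 ∤ N`: GOOD ORDINARY at `3`; `ρ̄_{E,3}` irreducible, NOT surjective, normaliser-of-split-Cartan
type `3Ns` — class X10b; analytic rank `0`; `#Ш_an = 9` (`ord₃ = 2`); census: Cha-certified under flag). Displayed binders:
`hGZK`; `r_an = 0`, `ord₃ #Ш_an = 2` (Cremona / engines); `hcard` = the exact `3`-descent line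
`dim_𝔽₃ Sel^(3)(E/ℚ) = 2` (two engines, T2-BATCH-G10); the pairing binders = the ctp-sel3/1.1 TARGET
document `ctp_cert_327184dt1.json` of `HOME/b2b-bsdres-x10/g10/ctp-sel3/certs/` (route A's matrix `G = [0 −1; 1 0]`,
alternating, rank `2`; VERIFIER B UNREAD at the time of writing — R-281(d) queue; referee R106.7 governs
booking). GLOBAL MINIMALITY of Cremona's model is a DISPLAYED HYPOTHESIS `hmin` for this record (additive at `2` with `2⁴ ∣ c₄`, `2⁶ ∥ c₆`:
outside the tree's bounded Kraus clauses F2a/F2c of `isGloballyMinimal_of_krausCriterion_bounded₂`; Kraus 1989 Prop. 2 in print). Kernel-decided here: `Δ ≠ 0`, `E[3]` irreducible (`ℓ = 7`,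
`#Ẽ(𝔽_{7}) = 5`, `a_{7} = 3`). Per pair; books nothing.
[cite: Miller2011LMS, Def. 1.1] [cite: FisherNewton2014, Thm. 1.3] [cite: Cremona2006, Table 1 (Cremona label 327184dt1)] -/
theorem bsdp_t327184dt1 (hGZK : rank_eq_analyticRank_of_analyticRank_le_one)
    (W : WeierstrassCurve ℚ) (hW : W = ⟨0, 1, 0, 974736, -1134484012⟩) [hmin : W.IsGloballyMinimal]
    (hr : W.analyticRank = 0) (hcard : Nat.card (W.selmerGroup (3 : ℤ)) = 9)
    {Q : Type*} [AddCommGroup Q] (B : W.sha →+ W.sha →+ Q) {x₁ x₂ : W.sha}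
    (hx₁ : 3 • x₁ = 0) (hx₂ : 3 • x₂ = 0)
    (h₁₁ : B x₁ x₁ = 0) (h₂₂ : B x₂ x₂ = 0) (h₁₂ : B x₁ x₂ ≠ 0) (h₂₁ : B x₂ x₁ ≠ 0)
    {q : ℚ} (hq : shaAn W = (q : ℂ)) (hv : padicValRat 3 q = 2) : BSDp W 3 := by
  subst hW
  have hE := isElliptic_of_discOf_ne_zero 0 1 0 974736 (-1134484012) (by decide +kernel)
  have hM := hmin
  haveI : Fact (Nat.Prime 7) := ⟨by norm_num⟩
  exact @bsdp_three_of_ainvs_of_ctpGram hGZK 0 1 0 974736 (-1134484012) _ hE hM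
    (@integralModelInt_eq_of_map_eq _ hM _ (map_mk_int _ _ _ _ _)) 7 5 _ (by decide) (by decide +kernel)
    card_t327184dt1_7 (by decide +kernel) hr hcard Q _ B x₁ x₂ hx₁ hx₂ h₁₁ h₂₂ h₁₂ h₂₁ q hq hv

/-- **`BSD(E,3)` for `427130j1` from the CTP-on-Sel³ certificate shape** (`N = 427130`; Cremona model
`[1, 1, 0, -2255337878, -41220294842668]`; `3 ∤ N`: GOOD ORDINARY at `3`; `ρ̄_{E,3}` irreducible, NOT surjective, normaliser-of-split-Cartan
type `3Ns` — class X10b; analytic rank `0`; `#Ш_an = 9` (`ord₃ = 2`); census: Jetchev-closable (q = 353; p213239)). Displayed binders: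
`hGZK`; `r_an = 0`, `ord₃ #Ш_an = 2` (Cremona / engines); `hcard` = the exact `3`-descent line
`dim_𝔽₃ Sel^(3)(E/ℚ) = 2` (two engines, T2-BATCH-G10); the pairing binders = the ctp-sel3/1.1 TARGET
document `ctp_cert_427130j1.json` of `HOME/b2b-bsdres-x10/g10/ctp-sel3/certs/` (route A's matrix `G = [0 1; −1 0]`,
alternating, rank `2`; VERIFIER B UNREAD at the time of writing — R-281(d) queue; referee R106.7 governs
booking). Kernel-decided here: `Δ ≠ 0`, global minimality (Kraus), `E[3]` irreducible (`ℓ = 7`,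
`#Ẽ(𝔽_{7}) = 5`, `a_{7} = 3`). Per pair; books nothing.
[cite: Miller2011LMS, Def. 1.1] [cite: FisherNewton2014, Thm. 1.3] [cite: Cremona2006, Table 1 (Cremona label 427130j1)] -/
theorem bsdp_t427130j1 (hGZK : rank_eq_analyticRank_of_analyticRank_le_one)
    (W : WeierstrassCurve ℚ) (hW : W = ⟨1, 1, 0, -2255337878, -41220294842668⟩)
    (hr : W.analyticRank = 0) (hcard : Nat.card (W.selmerGroup (3 : ℤ)) = 9)
    {Q : Type*} [AddCommGroup Q] (B : W.sha →+ W.sha →+ Q) {x₁ x₂ : W.sha}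
    (hx₁ : 3 • x₁ = 0) (hx₂ : 3 • x₂ = 0)
    (h₁₁ : B x₁ x₁ = 0) (h₂₂ : B x₂ x₂ = 0) (h₁₂ : B x₁ x₂ ≠ 0) (h₂₁ : B x₂ x₁ ≠ 0)
    {q : ℚ} (hq : shaAn W = (q : ℂ)) (hv : padicValRat 3 q = 2) : BSDp W 3 := by
  subst hW
  have hE := isElliptic_of_discOf_ne_zero 1 1 0 (-2255337878) (-41220294842668) (by decide +kernel)
  have hM := isGloballyMinimal_of_krausCriterion_bounded₂ 1 1 0 (-2255337878) (-41220294842668) (by decide +kernel)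
    (by decide +kernel) (by decide +kernel)
  haveI : Fact (Nat.Prime 7) := ⟨by norm_num⟩
  exact @bsdp_three_of_ainvs_of_ctpGram hGZK 1 1 0 (-2255337878) (-41220294842668) _ hE hM
    (@integralModelInt_eq_of_map_eq _ hM _ (map_mk_int _ _ _ _ _)) 7 5 _ (by decide) (by decide +kernel)
    card_t427130j1_7 (by decide +kernel) hr hcard Q _ B x₁ x₂ hx₁ hx₂ h₁₁ h₂₂ h₁₂ h₂₁ q hq hv

end Summit.BirchSwinnertonDyer.Rank1Residual.X10

end
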